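import Summits.BirchSwinnertonDyer.BirchSwinnertonDyer.Theorems.ThetaPartnerAtTwoSignedControlAtTwoShaThreeExtension
import Literature.NumberTheory.GaloisRepresentations.PPrimaryDevissage
import HarnessLib

/-!
# Poitou–Tate in degree `3` at the real places over a `2`-extension: dévissage to the trivial module of order `2`
# (K4 `SignedControlAtTwo` stub 3 `stub_poitouTateThreeRealRat`; Milne I Thm. 4.10 (c), `r = 3`)

Route `ThetaPartnerAtTwo` (TP2; crux shared with `ResidualThetaTransportAtTwo`), crux K4 `SignedControlAtTwo`
(stmt-BirchSwinnertonDyer-20309), line `eulerchar` v12, registered stub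
`stub_poitouTateThreeRealRat : poitouTate_three_realPlaces_injective ℚ`.  Seat `prover-bsd-wall-tp2-p3` (lead, gen 5).
Brick B3 of the lead's dévissage of that named fact (brick B1 = `…ShaThreeExtension`, the extension step).

* `realThree_injective_of_pGroup_quotient` — let `F` be a number field and `N₀ ⊴ Γ_F` a normal subgroup with
  `Γ_F/N₀` a finite `2`-group.  Suppose (hP) for every discrete `Γ_F`-module `W` of order `2` with TRIVIAL action,
  every class of `H³(F, W)` vanishing at all real places of `F` is `0`, and (h416) Milne I Cor. 4.16 over `F`
  (`poitouTate_two_realPlaces_surjective F`, named fact, hypothesis).  Then for every finite discrete `2`-primary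
  `Γ_F`-module `B` on which `N₀` acts trivially, every class of `H³(F, B)` vanishing at all real places is `0`.
  PROOF = the tree's `PPrimaryDevissage.subsingleton_two_of_pGroup_quotient` (Serre I §3.3 / II §3.1) with the
  vanishing of `H²` replaced by the real-place injectivity of `H³`: `Γ_F` acts on `B ≠ 0` through the `2`-group
  `Γ_F/N₀`, which fixes a non-zero vector (`exists_ne_zero_forall_apply_eq`), hence a stable line `ℤ b₁ ≅ ℤ/2` with
  trivial action (`exists_line`); induction on `#B` along `0 → ℤ b₁ → B → B/ℤ b₁ → 0` (`isSES_subtype_mkQ`) through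
  the extension step `ShaThree.IsSES.eq_zero_of_forall_localization_inl_three` (B1), whose archimedean input (h2) at
  the quotient is (h416).
  (Consumers take `N₀ :=` the preimage in `Γ_F` of the kernel of the action of `Γ_K` on `B`, for `F` the fixed
  field of a `2`-Sylow subgroup of `Gal(K(B)/K)` — the odd-degree descent, brick B2/B4.)

HONEST FRAMING: THEOREMS ONLY (no definition, no named fact, no `sorry`); CONDITIONAL on the displayed hypotheses
(hP) — the base case `H³(F, ℤ/2) ↪ ⊕_{w real} H³(F_w, ℤ/2)`, a class-field-theoretic statement (`Br(F)/2 ≅ ⊕_real ℤ/2`,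
`H³(F, 𝔾_m)[2] = 0`) NOT proved here — and (h416); closes no item by itself; BSD is not proved by any of this.

References: [MilneADT2006] I Thm. 4.10 (c), Cor. 4.16; [SerreGaloisCohomology1997] I §3.3 Cor. 1, II §3.1 Prop. 5
(the dévissage to simple modules `≅ ℤ/p`).
-/

set_option autoImplicit false
-- the Theorems namespace of this sub repeats the summit name by design (D-0017 nested layout)
set_option linter.dupNamespace false

noncomputable section

open CategoryTheory NumberField Field Function MulAction
open _root_.TopRep _root_.ContRepresentation _root_.ContinuousCohomology
open Literature.NumberTheory.GaloisRepresentations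
open Literature.NumberTheory.GaloisCohomology

namespace Summit.BirchSwinnertonDyer.BirchSwinnertonDyer.Theorems.SignedEC.ShaThree

section Devissage

variable {F : Type} [Field F] [NumberField F]

/-- **Dévissage over a `2`-extension for Milne I Thm. 4.10 (c)₃.**  `N₀ ⊴ Γ_F` with `Γ_F/N₀` a finite `2`-group;
(hP) real-place injectivity of `H³(F, W)` for every ORDER-`2` module `W` with trivial action; (h416) Milne I Cor. 4.16
over `F`.  Then real-place injectivity of `H³(F, B)` holds for every finite discrete `2`-primary `B` on which `N₀` acts
trivially. [cite: MilneADT2006, Ch. I, Thm. 4.10 (c) and Cor. 4.16] [cite: SerreGaloisCohomology1997, I §3.3 Cor. 1] -/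
theorem realThree_injective_of_pGroup_quotient (N₀ : Subgroup (absoluteGaloisGroup F)) [N₀.Normal]
    [Finite (absoluteGaloisGroup F ⧸ N₀)] (hQ : IsPGroup 2 (absoluteGaloisGroup F ⧸ N₀))
    (hP : ∀ (W : Type) [AddCommGroup W] [TopologicalSpace W] [DiscreteTopology W] [Finite W]
      (σ : DiscreteGaloisModule F W), (∀ (g : absoluteGaloisGroup F) (w : W), σ g w = w) → Nat.card W = 2 →
        ∀ c : galoisCohomology σ 3,
          (∀ w : InfinitePlace F, w.IsReal → galoisCohomology.localization σ (Sum.inl w) 3 c = 0) → c = 0)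
    (h416 : poitouTate_two_realPlaces_surjective F)
    (B : Type) [AddCommGroup B] [TopologicalSpace B] [DiscreteTopology B] [Finite B]
    (τ : DiscreteGaloisModule F B) (hB : IsPrimaryTorsion 2 B)
    (hN₀ : ∀ g ∈ N₀, ∀ b : B, τ g b = b) :
    ∀ c : galoisCohomology τ 3,
      (∀ w : InfinitePlace F, w.IsReal → galoisCohomology.localization τ (Sum.inl w) 3 c = 0) → c = 0 := by
  classical
  haveI : CompactSpace (absoluteGaloisGroup F) := absoluteGaloisGroup_compactSpace F
  suffices key : ∀ (n : ℕ) (B : Type) [AddCommGroup B] [TopologicalSpace B] [DiscreteTopology B]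
      [Finite B] (τ : DiscreteGaloisModule F B), IsPrimaryTorsion 2 B →
      (∀ g ∈ N₀, ∀ b : B, τ g b = b) → Nat.card B = n →
      ∀ c : galoisCohomology τ 3,
        (∀ w : InfinitePlace F, w.IsReal → galoisCohomology.localization τ (Sum.inl w) 3 c = 0) → c = 0 from
    key _ B τ hB hN₀ rfl
  intro n
  induction n using Nat.strong_induction_on with
  | _ n ih =>
    intro B _ _ _ _ τ hB hN₀ hn c hc
    by_cases hsub : Subsingleton B
    · exact (subsingleton_continuousCohomology_of_subsingleton τ.toTopRep 2).elim _ _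
    · haveI : Nontrivial B := not_subsingleton_iff_nontrivial.1 hsub
      obtain ⟨b, hb0, hbfix⟩ := exists_ne_zero_forall_apply_eq N₀ hQ τ hB hN₀
      obtain ⟨b₁, hb₁0, hpb₁, hb₁fix⟩ := exists_line τ hB b hb0 hbfix
      let W₁ : Submodule ℤ B := Submodule.span ℤ {b₁}
      have hW₁ : ∀ g, W₁ ≤ W₁.comap (τ g) := span_singleton_le_comap τ b₁ hb₁fix
      have hSES := isSES_subtype_mkQ τ W₁ hW₁
      have hcardW : Nat.card W₁ = 2 := natCard_span_singleton b₁ hb₁0 hpb₁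
      haveI : Finite W₁ := Subtype.finite
      -- the line: hypothesis (hP)
      have h₁ : ∀ a : galoisCohomology (show DiscreteGaloisModule F W₁ from τ.subrepresentation W₁ hW₁) 3,
          (∀ w : InfinitePlace F, w.IsReal →
            galoisCohomology.localization (show DiscreteGaloisModule F W₁ from τ.subrepresentation W₁ hW₁)
              (Sum.inl w) 3 a = 0) → a = 0 :=
        hP W₁ (τ.subrepresentation W₁ hW₁) (subrepresentation_span_apply τ b₁ hb₁fix) hcardW
      -- the quotient, by induction
      haveI : Finite (B ⧸ W₁) := Finite.of_surjective _ (Submodule.Quotient.mk_surjective W₁)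
      have hlt : Nat.card (B ⧸ W₁) < n := by
        have hmul : Nat.card B = Nat.card (B ⧸ W₁) * Nat.card W₁ :=
          AddSubgroup.card_eq_card_quotient_mul_card_addSubgroup W₁.toAddSubgroup
        rw [hn, hcardW] at hmul
        rw [hmul]
        exact (Nat.lt_mul_iff_one_lt_right Nat.card_pos).2 one_lt_two
      have htriv : ∀ g ∈ N₀, ∀ x : B ⧸ W₁, τ.quotient W₁ hW₁ g x = x := fun g hg x => by
        induction x using Submodule.Quotient.induction_on with
        | _ m => rw [ContinuousRep.quotient_apply_mk, hN₀ g hg m]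
      have h₃ : ∀ a : galoisCohomology (show DiscreteGaloisModule F (B ⧸ W₁) from τ.quotient W₁ hW₁) 3,
          (∀ w : InfinitePlace F, w.IsReal →
            galoisCohomology.localization (show DiscreteGaloisModule F (B ⧸ W₁) from τ.quotient W₁ hW₁)
              (Sum.inl w) 3 a = 0) → a = 0 :=
        ih _ hlt (B ⧸ W₁) (τ.quotient W₁ hW₁) (hB.quotient W₁) htriv rfl
      -- Cor. 4.16 at the quotient: hypothesis (h416)
      have h₂ := h416 (B ⧸ W₁) (τ.quotient W₁ hW₁)
      exact IsSES.eq_zero_of_forall_localization_inl_three hSES h₁ h₃ h₂ c hc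

end Devissage

end Summit.BirchSwinnertonDyer.BirchSwinnertonDyer.Theorems.SignedEC.ShaThree

end
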